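import Literature.Combinatorics.StablePolynomials.PartialJensenMultipliers
import Literature.Combinatorics.StablePolynomials.StabilityPreserversAllDegrees
import Literature.Combinatorics.StablePolynomials.HardLiebSokal
import HarnessLib

/-!
# Finite-order differential operators preserving stability (Borcea–Brändén II, Theorem 7.3 (a), sufficiency)

J. Borcea, P. Brändén, *The Lee–Yang and Pólya–Schur programs. II. Theory of stable polynomials and
applications*, Comm. Pure Appl. Math. 62 (2009) 1595–1631 (arXiv:0809.3087), §7:

> Recall that a (Weyl algebra) finite order linear partial differential operator with polynomial
> coefficients is an operator `T : 𝕂[z_1,…,z_n] → 𝕂[z_1,…,z_n]`, where `𝕂 = ℂ` or `ℝ`, of the form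
> `T = Σ_{α ≤ β} Q_α(z) ∂^α/∂z^α`, where `β ∈ ℕⁿ` and `Q_α ∈ 𝕂[z_1,…,z_n]`, `α ≤ β`.
>
> **Theorem 7.3.** Let `T` be defined as above and set `F(z,w) = Σ_{α ≤ β} Q_α(z) w^α ∈ 𝕂[z_1,…,z_n,w_1,…,w_n]`.
> Then (a) `T` preserves stability if and only if `F(z,-w)` is stable; (b) `T` preserves real stability if
> and only if `F(z,-w)` is real stable.

The printed proof reads the statement off the *transcendental* characterization of stability preservers
(Theorems 7.1/7.2, `T[e^{-z·w}] = e^{-z·w} F(z,-w)`), which the tree does not have. This file proves the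
**sufficiency halves of (a) and (b)** — if `F(z,-w)` is stable (real stable) then `T(f)` is stable (real
stable) or identically zero for every stable (real stable) `f` — by a purely algebraic route through the tree's bounded-degree theorem (part I, Theorem 1.1,
`BorceaBranden_stabilityPreserver_iff'`) and the partial Jensen multiplier `Λ̄` of part I, §5.3
(`wDescFactorialOp`, `PartialJensenMultipliers.lean`):

* `T` is encoded by its polynomial `F ∈ ℂ[z_τ, w_τ]` (variables `τ ⊕ τ`, `Sum.inl` = `z`, `Sum.inr` = `w`):
  `weylOp F (f) = Σ_{(γ,α)} c_{γ,α} z^γ ∂^α f` where `F = Σ c_{γ,α} z^γ w^α` (so `Q_α = Σ_γ c_{γ,α} z^γ`);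
  `∂^α = Π_i ∂_i^{α_i}` is `mixedPderiv α`, with `∂^α z^s = (s)_α z^{s-α}` (`mixedPderiv_monomial`).
* For `κ ∈ ℕⁿ` the bounded-degree symbol is `T[(z+w)^κ] = Σ c_{γ,α} z^γ (κ)_α (z+w)^{κ-α}`, and for
  `z, w ∈ Hⁿ` (so `z_i + w_i ∈ H`, `-1/(z_i+w_i) ∈ H`)
  `T[(z+w)^κ](z,w) = (z+w)^κ · (Λ̄_κ G)(z, -1/(z+w))`, `G(z,w) = F(z,-w)`
  (`eval_weylOp_symbol`), where `Λ̄_κ G = Σ (κ)_α c_{γ,α} z^γ (-w)^α` is stable or zero since `G` is stable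
  (`wDescFactorialOp_stable_or_zero`). If `Λ̄_κ G` is stable the symbol is stable and Theorem 1.1 applies on
  `ℂ_κ[z]`; if `Λ̄_κ G = 0` then every `α` occurring in `F` has `α ≰ κ` and `T` kills `ℂ_κ[z]`. Taking
  `κ = (deg_{z_i} f)_i` gives the claim for every stable `f`.

Part (b) (sufficiency) follows by complexification, the operators being defined over any commutative ring
(`map_weylOp`, `map_negW`). The necessity halves are not treated here.
-- TODO(general form): Theorem 7.3 (a), (b) necessity, loc. cit.

## Main results (namespace `Literature.Combinatorics.StablePolynomials`)

* `iterate_pderiv_monomial`, `mixedPderiv`, `mixedPderiv_monomial`, `mixedPderiv_eq_zero_of_degreeOf_lt`,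
  `mixedPderiv_prod_X_add_C_pow`.
* `zPart`, `wPart`, `weylOp`, `weylOp_apply`; `negW` (`F(z,-w)`), `negW_monomial`.
* `eval_weylOp_symbol` — the symbol identity; **`BorceaBranden_weylOp_stable_or_zero`** — Theorem 7.3 (a),
  sufficiency.
* `map_mixedPderiv`, `map_weylOp`, `map_negW`; **`BorceaBranden_weylOp_realStable_or_zero`** — Theorem 7.3 (b),
  sufficiency.

## References

* [BorceaBranden2009II] J. Borcea, P. Brändén, Comm. Pure Appl. Math. 62 (2009) 1595–1631, §7 Thm. 7.3.
* [BorceaBranden2009] J. Borcea, P. Brändén, Invent. Math. 177 (2009) 541–569, §1.1 Thm. 1.1 and §5.3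
  (the operator `Λ̄`).
-/

noncomputable section

open MvPolynomial Finset

namespace Literature.Combinatorics.StablePolynomials

variable {τ : Type*}

/-! ## §1 Mixed partial derivatives `∂^α` -/

section Mixed

variable {R : Type*} [CommRing R]

/-- **`∂_i^k (c z^s) = (s_i)_k c z^{s - k e_i}`** (falling factorial; any commutative coefficient ring).
[cite: BorceaBranden2009II, §7 (the operators `∂^α/∂z^α` of (7.2))] -/
theorem iterate_pderiv_monomial (i : τ) (k : ℕ) (s : τ →₀ ℕ) (c : R) :
    (pderiv i)^[k] (monomial s c) =
      (((s i).descFactorial k : ℕ) : R) • monomial (s - Finsupp.single i k) c := by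
  induction k with
  | zero =>
    rw [Function.iterate_zero_apply, Nat.descFactorial_zero, Nat.cast_one, one_smul, Finsupp.single_zero,
      tsub_zero]
  | succ k ih =>
    rw [Function.iterate_succ_apply', ih, Derivation.map_smul, pderiv_monomial, Finsupp.tsub_apply,
      Finsupp.single_eq_same, tsub_tsub, ← Finsupp.single_add, Nat.descFactorial_succ, Nat.cast_mul,
      show monomial (s - Finsupp.single i (k + 1)) (c * ((s i - k : ℕ) : R)) =
          ((s i - k : ℕ) : R) • monomial (s - Finsupp.single i (k + 1)) c by
        rw [smul_monomial, smul_eq_mul, mul_comm],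
      smul_smul, mul_comm (((s i).descFactorial k : ℕ) : R)]

variable [Fintype τ]

/-- **The mixed derivative `∂^α = Π_i ∂_i^{α_i}`** as a linear operator on `R[z_τ]` (the product of the
commuting operators `∂_i^{α_i}`, composed along `univ.toList`). [cite: BorceaBranden2009II, §7 ((7.2):
"`T = Σ_{α ≤ β} Q_α(z) ∂^α/∂z^α`")] -/
def mixedPderiv (α : τ → ℕ) : MvPolynomial τ R →ₗ[R] MvPolynomial τ R :=
  ((Finset.univ : Finset τ).toList.map fun i => (pderiv i).toLinearMap ^ α i).prod

omit [Fintype τ] in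
/-- The list-product computation behind `mixedPderiv_monomial`. [cite: BorceaBranden2009II, §7 (the
operators `∂^α`)] -/
theorem listProd_pderiv_pow_monomial [DecidableEq τ] (α : τ → ℕ) (l : List τ) (hl : l.Nodup)
    (s : τ →₀ ℕ) (c : R) :
    (l.map fun i => (pderiv i).toLinearMap ^ α i).prod (monomial s c) =
      ((∏ j ∈ l.toFinset, (s j).descFactorial (α j) : ℕ) : R) •
        monomial (s - ∑ j ∈ l.toFinset, Finsupp.single j (α j)) c := by
  induction l with
  | nil => simp
  | cons i l ih =>
    have hil : i ∉ l := (List.nodup_cons.1 hl).1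
    have hil' : i ∉ l.toFinset := fun h => hil (List.mem_toFinset.1 h)
    have hSi : (∑ j ∈ l.toFinset, Finsupp.single j (α j)) i = 0 := by
      rw [Finsupp.finsetSum_apply]
      exact Finset.sum_eq_zero fun j hj =>
        Finsupp.single_eq_of_ne (fun hji => hil' (hji ▸ hj))
    rw [List.map_cons, List.prod_cons, Module.End.mul_apply, ih (List.nodup_cons.1 hl).2, map_smul,
      Module.End.pow_apply, show ⇑((pderiv i).toLinearMap) = ⇑(pderiv i : Derivation R (MvPolynomial τ R)
        (MvPolynomial τ R)) from rfl, iterate_pderiv_monomial, smul_smul, Finsupp.tsub_apply, hSi,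
      Nat.sub_zero, List.toFinset_cons, Finset.prod_insert hil', Finset.sum_insert hil', Nat.cast_mul,
      tsub_tsub, add_comm (∑ j ∈ l.toFinset, Finsupp.single j (α j)), mul_comm]

/-- **`∂^α (c z^s) = (s)_α c z^{s-α}`** with `(s)_α = Π_i s_i!/(s_i-α_i)!` (`= 0` unless `α ≤ s`;
`multiDescFactorial`). [cite: BorceaBranden2009II, §7 (the operators `∂^α`); BorceaBranden2009, §5
(the symbol `(β)_α`)] -/
theorem mixedPderiv_monomial [DecidableEq τ] (α : τ → ℕ) (s : τ →₀ ℕ) (c : R) :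
    mixedPderiv α (monomial s c) = ((multiDescFactorial ⇑s α : ℕ) : R) • monomial (s - toF α) c := by
  rw [mixedPderiv, listProd_pderiv_pow_monomial α _ (Finset.nodup_toList _), Finset.toList_toFinset,
    multiDescFactorial]
  congr 2
  rw [← Finsupp.univ_sum_single (toF α)]
  rfl

/-- `∂^α f = 0` if `f` has degree `< α_i` in some variable `z_i`. [cite: BorceaBranden2009II, §7 (the
operators `∂^α` on `𝕂[z]`)] -/
theorem mixedPderiv_eq_zero_of_degreeOf_lt [DecidableEq τ] {α : τ → ℕ} {f : MvPolynomial τ R} {i : τ}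
    (h : degreeOf i f < α i) : mixedPderiv α f = 0 := by
  conv_lhs => rw [f.as_sum]
  rw [map_sum]
  refine Finset.sum_eq_zero fun s hs => ?_
  rw [mixedPderiv_monomial, multiDescFactorial,
    Finset.prod_eq_zero (Finset.mem_univ i) (Nat.descFactorial_eq_zero_iff_lt.2
      (lt_of_le_of_lt (monomial_le_degreeOf i hs) h)), Nat.cast_zero, zero_smul]

/-- The list-product computation behind `mixedPderiv_prod_X_add_C_pow`. [cite: BorceaBranden2009II, §7;
BorceaBranden2009, §1.1 (the symbol `T[(z+w)^κ]`)] -/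
theorem listProd_pderiv_pow_prod_X_add_C_pow [DecidableEq τ] (α : τ → ℕ) (l : List τ) (hl : l.Nodup)
    (w : τ → ℂ) (m : τ → ℕ) :
    (l.map fun i => (pderiv i).toLinearMap ^ α i).prod (∏ j, (X j + C (w j)) ^ m j : MvPolynomial τ ℂ) =
      ((∏ j ∈ l.toFinset, (m j).descFactorial (α j) : ℕ) : ℂ) •
        ∏ j, (X j + C (w j)) ^ (if j ∈ l.toFinset then m j - α j else m j) := by
  induction l with
  | nil => simp
  | cons i l ih =>
    have hil : i ∉ l := (List.nodup_cons.1 hl).1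
    have hil' : i ∉ l.toFinset := fun h => hil (List.mem_toFinset.1 h)
    -- split off the factor `i` before and after differentiating
    have hsplit : (∏ j, (X j + C (w j)) ^ (if j ∈ l.toFinset then m j - α j else m j) : MvPolynomial τ ℂ) =
        (X i + C (w i)) ^ m i *
          ∏ j ∈ univ.erase i, (X j + C (w j)) ^ (if j ∈ l.toFinset then m j - α j else m j) := by
      rw [← Finset.mul_prod_erase univ
        (fun j => (X j + C (w j)) ^ (if j ∈ l.toFinset then m j - α j else m j)) (mem_univ i)]
      simp only [hil', if_false]
    have hR : (∏ j, (X j + C (w j)) ^ (if j ∈ (i :: l).toFinset then m j - α j else m j) : MvPolynomial τ ℂ) =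
        (X i + C (w i)) ^ (m i - α i) *
          ∏ j ∈ univ.erase i, (X j + C (w j)) ^ (if j ∈ l.toFinset then m j - α j else m j) := by
      rw [← Finset.mul_prod_erase univ
        (fun j => (X j + C (w j)) ^ (if j ∈ (i :: l).toFinset then m j - α j else m j)) (mem_univ i)]
      congr 1
      · simp
      · refine Finset.prod_congr rfl fun j hj => ?_
        have hji : j ≠ i := Finset.ne_of_mem_erase hj
        simp [List.toFinset_cons, Finset.mem_insert, hji]
    have hq : pderiv i (∏ j ∈ univ.erase i,
        (X j + C (w j)) ^ (if j ∈ l.toFinset then m j - α j else m j) : MvPolynomial τ ℂ) = 0 :=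
      pderiv_prod_X_add_C_pow_eq_zero i _ (Finset.notMem_erase i univ) w _
    rw [List.map_cons, List.prod_cons, Module.End.mul_apply, ih (List.nodup_cons.1 hl).2, map_smul,
      Module.End.pow_apply, show ⇑((pderiv i).toLinearMap) = ⇑(pderiv i : Derivation ℂ (MvPolynomial τ ℂ)
        (MvPolynomial τ ℂ)) from rfl, hsplit, iterate_pderiv_mul_of_right i hq, iterate_pderiv_X_add_C_pow,
      smul_mul_assoc, smul_smul, hR, List.toFinset_cons, Finset.prod_insert hil', Nat.cast_mul]
    congr 1
    exact mul_comm _ _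

/-- **`∂^α (z+w)^m = (m)_α (z+w)^{m-α}`** for the product `Π_j (z_j + w_j)^{m_j}`.
[cite: BorceaBranden2009, §1.1 (the symbol `T[(z+w)^κ]`); BorceaBranden2009II, §7] -/
theorem mixedPderiv_prod_X_add_C_pow [DecidableEq τ] (α : τ → ℕ) (w : τ → ℂ) (m : τ → ℕ) :
    mixedPderiv α (∏ j, (X j + C (w j)) ^ m j : MvPolynomial τ ℂ) =
      ((multiDescFactorial m α : ℕ) : ℂ) • ∏ j, (X j + C (w j)) ^ (m j - α j) := by
  rw [mixedPderiv, listProd_pderiv_pow_prod_X_add_C_pow α _ (Finset.nodup_toList _), Finset.toList_toFinset,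
    multiDescFactorial]
  simp only [Finset.mem_univ, if_true]

end Mixed

/-! ## §2 The operator `T = Σ_α Q_α(z) ∂^α` and the polynomial `F(z,-w)` -/

section Weyl

variable [Fintype τ] {R : Type*} [CommRing R]

/-- The `z`-exponents of a monomial `z^γ w^α` of `ℂ[z_τ,w_τ]`. [cite: BorceaBranden2009II, §7 (the polynomial
`F(z,w) = Σ Q_α(z) w^α`)] -/
def zPart (s : τ ⊕ τ →₀ ℕ) : τ →₀ ℕ := (Finsupp.sumFinsuppEquivProdFinsupp s).1

/-- The `w`-exponents of a monomial `z^γ w^α` of `ℂ[z_τ,w_τ]`. [cite: BorceaBranden2009II, §7 (the polynomial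
`F(z,w) = Σ Q_α(z) w^α`)] -/
def wPart (s : τ ⊕ τ →₀ ℕ) : τ →₀ ℕ := (Finsupp.sumFinsuppEquivProdFinsupp s).2

omit [Fintype τ] in
/-- `zPart s i = s (inl i)`. [cite: BorceaBranden2009II, §7] -/
@[simp] theorem zPart_apply (s : τ ⊕ τ →₀ ℕ) (i : τ) : zPart s i = s (Sum.inl i) :=
  Finsupp.fst_sumFinsuppEquivProdFinsupp s i

omit [Fintype τ] in
/-- `wPart s i = s (inr i)`. [cite: BorceaBranden2009II, §7] -/
@[simp] theorem wPart_apply (s : τ ⊕ τ →₀ ℕ) (i : τ) : wPart s i = s (Sum.inr i) :=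
  Finsupp.snd_sumFinsuppEquivProdFinsupp s i

/-- **The finite-order differential operator `T_F = Σ_{(γ,α)} c_{γ,α} z^γ ∂^α`** attached to
`F = Σ c_{γ,α} z^γ w^α ∈ ℂ[z_τ, w_τ]`, i.e. `T = Σ_α Q_α(z) ∂^α/∂z^α` with `Q_α(z) = Σ_γ c_{γ,α} z^γ` and
`F(z,w) = Σ_α Q_α(z) w^α`. [cite: BorceaBranden2009II, §7 ((7.2) and Thm. 7.3: "`F(z,w) = Σ_{α≤β} Q_α(z) w^α`")] -/
def weylOp (F : MvPolynomial (τ ⊕ τ) R) : MvPolynomial τ R →ₗ[R] MvPolynomial τ R :=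
  ∑ s ∈ F.support, coeff s F • (LinearMap.mulLeft R (monomial (zPart s) (1 : R)) ∘ₗ mixedPderiv ⇑(wPart s))

/-- `T_F(f) = Σ_s c_s z^{γ_s} ∂^{α_s} f`. [cite: BorceaBranden2009II, §7 (7.2)] -/
theorem weylOp_apply (F : MvPolynomial (τ ⊕ τ) R) (f : MvPolynomial τ R) :
    weylOp F f = ∑ s ∈ F.support, coeff s F • (monomial (zPart s) (1 : R) * mixedPderiv ⇑(wPart s) f) := by
  rw [weylOp, LinearMap.sum_apply]
  rfl

/-- **`F(z,-w)`**: the substitution `w_i ↦ -w_i`. [cite: BorceaBranden2009II, §7 Thm. 7.3 ("`F(z,-w)` is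
stable")] -/
def negW (F : MvPolynomial (τ ⊕ τ) R) : MvPolynomial (τ ⊕ τ) R :=
  bind₁ (Sum.elim (fun i => X (Sum.inl i)) fun i => -X (Sum.inr i)) F

omit [Fintype τ] in
/-- `F(z,-w)` evaluated: `(negW F)(z,w) = F(z,-w)`. [cite: BorceaBranden2009II, §7 Thm. 7.3] -/
theorem eval_negW (F : MvPolynomial (τ ⊕ τ) R) (z w : τ → R) :
    eval (Sum.elim z w) (negW F) = eval (Sum.elim z (-w)) F := by
  have h : (fun j => eval (Sum.elim z w) (Sum.elim (fun i => X (Sum.inl i)) (fun i => -X (Sum.inr i)) j)) =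
      Sum.elim z (-w) := by
    funext j
    rcases j with i | i <;> simp
  rw [negW]
  change eval₂Hom (RingHom.id R) (Sum.elim z w) (bind₁ _ F) = _
  rw [eval₂Hom_bind₁]
  change eval (fun j => eval (Sum.elim z w)
    (Sum.elim (fun i => X (Sum.inl i)) (fun i => -X (Sum.inr i)) j)) F = _
  rw [h]

/-- `negW (c z^γ w^α) = (-1)^{|α|} c z^γ w^α`. [cite: BorceaBranden2009II, §7 Thm. 7.3] -/
theorem negW_monomial (s : τ ⊕ τ →₀ ℕ) (c : R) :
    negW (monomial s c) = ((-1 : R) ^ ∑ i, s (Sum.inr i)) • monomial s c := by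
  rw [negW, bind₁_monomial, Finset.prod_subset (Finset.subset_univ s.support)
    (fun j _ hj => by rw [Finsupp.notMem_support_iff.1 hj, pow_zero]), Fintype.prod_sum_type]
  simp only [Sum.elim_inl, Sum.elim_inr]
  have h1 : (∏ i, (-X (Sum.inr i) : MvPolynomial (τ ⊕ τ) R) ^ s (Sum.inr i)) =
      ∏ i, ((-1 : MvPolynomial (τ ⊕ τ) R) ^ s (Sum.inr i) * X (Sum.inr i) ^ s (Sum.inr i)) :=
    Finset.prod_congr rfl fun i _ => neg_pow _ _
  rw [h1, Finset.prod_mul_distrib, Finset.prod_pow_eq_pow_sum, smul_eq_C_mul, monomial_eq,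
    Finsupp.prod_fintype _ _ fun j => pow_zero _, Fintype.prod_sum_type, map_pow, map_neg, C_1]
  ring

variable [DecidableEq τ]

omit [DecidableEq τ] in
/-- **`Λ̄_κ(F(z,-w)) = Σ_s (κ)_{α_s} (-1)^{|α_s|} c_s z^{γ_s} w^{α_s}`.** [cite: BorceaBranden2009, §5.3 (the
operator `Λ̄`); BorceaBranden2009II, §7 Thm. 7.3] -/
theorem wDescFactorialOp_negW (κ : τ → ℕ) (F : MvPolynomial (τ ⊕ τ) ℂ) :
    wDescFactorialOp κ (negW F) = ∑ s ∈ F.support, monomial s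
      (((multiDescFactorial κ (fun i => s (Sum.inr i)) : ℕ) : ℂ) * ((-1 : ℂ) ^ ∑ i, s (Sum.inr i)) *
        coeff s F) := by
  conv_lhs => rw [F.as_sum]
  rw [negW, map_sum, map_sum]
  refine Finset.sum_congr rfl fun s _ => ?_
  rw [← negW, negW_monomial, map_smul, wDescFactorialOp_monomial, smul_monomial]
  congr 1
  ring

/-- Coefficients of `Λ̄_κ(F(z,-w))`. [cite: BorceaBranden2009, §5.3; BorceaBranden2009II, §7 Thm. 7.3] -/
theorem coeff_wDescFactorialOp_negW (κ : τ → ℕ) (F : MvPolynomial (τ ⊕ τ) ℂ) (s : τ ⊕ τ →₀ ℕ) :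
    coeff s (wDescFactorialOp κ (negW F)) =
      ((multiDescFactorial κ (fun i => s (Sum.inr i)) : ℕ) : ℂ) * ((-1 : ℂ) ^ ∑ i, s (Sum.inr i)) *
        coeff s F := by
  rw [wDescFactorialOp_negW, coeff_sum]
  by_cases hs : s ∈ F.support
  · rw [Finset.sum_eq_single_of_mem s hs fun t _ hts => by rw [coeff_monomial, if_neg hts], coeff_monomial,
      if_pos rfl]
  · rw [notMem_support_iff.1 hs, mul_zero]
    exact Finset.sum_eq_zero fun t ht => by
      rw [coeff_monomial]
      exact if_neg fun hts => hs (by rw [← hts]; exact ht)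

end Weyl

/-! ## §3 The bounded-degree symbol of `T_F` and `Λ̄_κ` -/

section Symbol

variable [Fintype τ] [DecidableEq τ]

/-- **The symbol identity.** For `z, w` with `z_i + w_i ≠ 0`,
`T_F[(z+w)^κ](z) = (Π_i (z_i+w_i)^{κ_i}) · (Λ̄_κ F(z,-·))(z, -1/(z+w))`.
[cite: BorceaBranden2009II, §7 Thm. 7.3 (a); BorceaBranden2009, §1.1 (`G_T(z,w) = T[(z+w)^κ]`) and §5.3 (`Λ̄`)] -/
theorem eval_weylOp_symbol (F : MvPolynomial (τ ⊕ τ) ℂ) (κ : τ → ℕ) (z w : τ → ℂ)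
    (hzw : ∀ i, z i + w i ≠ 0) :
    eval z (weylOp F (∏ j, (X j + C (w j)) ^ κ j)) =
      (∏ i, (z i + w i) ^ κ i) *
        eval (Sum.elim z fun i => -(z i + w i)⁻¹) (wDescFactorialOp κ (negW F)) := by
  rw [weylOp_apply, map_sum, wDescFactorialOp_negW, map_sum, Finset.mul_sum]
  refine Finset.sum_congr rfl fun s _ => ?_
  rw [mixedPderiv_prod_X_add_C_pow, smul_eval, mul_smul_comm, smul_eval, _root_.map_mul, eval_monomial,
    Finsupp.prod_fintype _ _ fun j => pow_zero _, _root_.map_prod, eval_monomial,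
    Finsupp.prod_fintype _ _ fun j => pow_zero _, Fintype.prod_sum_type]
  simp only [one_mul, map_pow, map_add, eval_X, eval_C, zPart_apply, Sum.elim_inl, Sum.elim_inr, wPart_apply]
  have hw : (⇑(wPart s) : τ → ℕ) = fun i => s (Sum.inr i) := funext fun i => wPart_apply s i
  rw [hw]
  by_cases hle : (fun i => s (Sum.inr i)) ≤ κ
  · -- `(z+w)^κ · (-1)^{|α|} · Π (-(z+w)⁻¹)^{α} = (z+w)^{κ-α}`
    have hprod : (∏ i, (z i + w i) ^ κ i) * ((-1 : ℂ) ^ (∑ i, s (Sum.inr i)) *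
        ∏ i, (-(z i + w i)⁻¹) ^ s (Sum.inr i)) = ∏ i, (z i + w i) ^ (κ i - s (Sum.inr i)) := by
      rw [← Finset.prod_pow_eq_pow_sum, ← Finset.prod_mul_distrib, ← Finset.prod_mul_distrib]
      refine Finset.prod_congr rfl fun i _ => ?_
      rw [← mul_pow, neg_one_mul, neg_neg, inv_pow, pow_sub₀ _ (hzw i) (hle i)]
    linear_combination
      (-(coeff s F * ((multiDescFactorial κ (fun i => s (Sum.inr i)) : ℕ) : ℂ) *
        ∏ x, z x ^ s (Sum.inl x))) * hprod
  · rw [multiDescFactorial_eq_zero hle, Nat.cast_zero]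
    ring

/-- **The symbol of `T_F` on `ℂ_κ[z]` is stable when `Λ̄_κ(F(z,-w))` is.** [cite: BorceaBranden2009II, §7
Thm. 7.3 (a); BorceaBranden2009, §1.1 Thm. 1.1] -/
theorem isUpperHalfPlaneStable_symbol_weylOp {F : MvPolynomial (τ ⊕ τ) ℂ} {κ : τ → ℕ}
    (hH : IsUpperHalfPlaneStable (wDescFactorialOp κ (negW F))) :
    IsUpperHalfPlaneStable (boundedDegreeSymbol κ (weylOp F)) := by
  rw [isUpperHalfPlaneStable_boundedDegreeSymbol_iff]
  intro z w hz hw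
  have hzw : ∀ i, 0 < (z i + w i).im := fun i => by rw [Complex.add_im]; exact add_pos (hz i) (hw i)
  rw [eval_weylOp_symbol F κ z w fun i => fun h => (hzw i).ne' (by rw [h, Complex.zero_im])]
  refine mul_ne_zero (Finset.prod_ne_zero_iff.2 fun i _ => pow_ne_zero _ fun h => (hzw i).ne'
    (by rw [h, Complex.zero_im])) (hH _ ?_)
  rintro (i | i)
  · simpa using hz i
  · simpa using neg_inv_im_pos (hzw i)

end Symbol

/-! ## §4 Theorem 7.3 (a), sufficiency -/

section Main

variable [Fintype τ] [DecidableEq τ]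

/-- **`T_F` on `ℂ_κ[z]`**: if `F(z,-w)` is stable then `T_F` maps the stable polynomials of degree `≤ κ` to
stable polynomials or to `0`. [cite: BorceaBranden2009II, §7 Thm. 7.3 (a); BorceaBranden2009, §1.1 Thm. 1.1] -/
theorem weylOp_stable_or_zero_of_degreeOf_le {F : MvPolynomial (τ ⊕ τ) ℂ}
    (hF : IsUpperHalfPlaneStable (negW F)) (κ : τ → ℕ) {f : MvPolynomial τ ℂ}
    (hdeg : ∀ i, degreeOf i f ≤ κ i) (hf : IsUpperHalfPlaneStable f) :
    IsUpperHalfPlaneStable (weylOp F f) ∨ weylOp F f = 0 := by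
  rcases wDescFactorialOp_stable_or_zero κ hF with hH | hH
  · exact (BorceaBranden_stabilityPreserver_iff' κ (weylOp F)).2
      (Or.inr (isUpperHalfPlaneStable_symbol_weylOp hH)) f hdeg hf
  · -- `Λ̄_κ(F(z,-w)) = 0`: every monomial `z^γ w^α` of `F` has `α ≰ κ`, so `∂^α` kills `ℂ_κ[z]`
    right
    rw [weylOp_apply]
    refine Finset.sum_eq_zero fun s hs => ?_
    have hnle : ¬ (⇑(wPart s) : τ → ℕ) ≤ κ := fun hle => by
      have h0 := congr_arg (coeff s) hH
      rw [coeff_wDescFactorialOp_negW, coeff_zero] at h0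
      exact mul_ne_zero (mul_ne_zero (Nat.cast_ne_zero.2 (multiDescFactorial_ne_zero hle))
        (pow_ne_zero _ (neg_ne_zero.2 one_ne_zero))) (mem_support_iff.1 hs) h0
    obtain ⟨i, hi⟩ : ∃ i, κ i < wPart s i := by
      by_contra hall
      push Not at hall
      exact hnle fun i => hall i
    rw [mixedPderiv_eq_zero_of_degreeOf_lt (lt_of_le_of_lt (hdeg i) hi), mul_zero, smul_zero]

/-- **Borcea–Brändén II, Theorem 7.3 (a), sufficiency.** Let `T = Σ_{α ≤ β} Q_α(z) ∂^α/∂z^α` be a finite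
order linear partial differential operator with polynomial coefficients on `ℂ[z_1,…,z_n]` and
`F(z,w) = Σ_α Q_α(z) w^α`. If `F(z,-w)` is stable then `T` preserves stability: for every stable `f`,
`T(f)` is stable or identically zero. [cite: BorceaBranden2009II, §7 Thm. 7.3 (a)] -/
theorem BorceaBranden_weylOp_stable_or_zero {F : MvPolynomial (τ ⊕ τ) ℂ}
    (hF : IsUpperHalfPlaneStable (negW F)) {f : MvPolynomial τ ℂ} (hf : IsUpperHalfPlaneStable f) :
    IsUpperHalfPlaneStable (weylOp F f) ∨ weylOp F f = 0 :=
  weylOp_stable_or_zero_of_degreeOf_le hF (fun i => degreeOf i f) (fun _ => le_rfl) hf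

end Main

/-! ## §5 Theorem 7.3 (b), sufficiency (real stability) -/

section Real

variable [Fintype τ]

/-- `map` commutes with `∂^α`. [cite: BorceaBranden2009II, §7 Thm. 7.3 (b) (`𝕂 = ℝ`: the same operators
over `ℝ`)] -/
theorem map_mixedPderiv {R S : Type*} [CommRing R] [CommRing S] [DecidableEq τ] (φ : R →+* S)
    (α : τ → ℕ) (f : MvPolynomial τ R) : map φ (mixedPderiv α f) = mixedPderiv α (map φ f) := by
  induction f using MvPolynomial.induction_on' with
  | monomial s c =>
    rw [mixedPderiv_monomial, map_monomial, mixedPderiv_monomial, smul_eq_C_mul, smul_eq_C_mul,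
      _root_.map_mul, map_C, map_natCast, map_monomial]
  | add p q hp hq => rw [map_add, map_add, map_add, hp, hq, map_add]

/-- **Complexification of `T_F`**: `map φ (T_F f) = T_{map φ F} (map φ f)` for injective `φ`.
[cite: BorceaBranden2009II, §7 Thm. 7.3 (b)] -/
theorem map_weylOp {R S : Type*} [CommRing R] [CommRing S] [DecidableEq τ] {φ : R →+* S}
    (hφ : Function.Injective φ) (F : MvPolynomial (τ ⊕ τ) R) (f : MvPolynomial τ R) :
    map φ (weylOp F f) = weylOp (map φ F) (map φ f) := by
  rw [weylOp_apply, weylOp_apply, map_sum, support_map_of_injective _ hφ]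
  refine Finset.sum_congr rfl fun s _ => ?_
  rw [coeff_map, smul_eq_C_mul, smul_eq_C_mul, _root_.map_mul, _root_.map_mul, map_C, map_monomial,
    map_one, map_mixedPderiv]

omit [Fintype τ] in
/-- `map φ (F(z,-w)) = (map φ F)(z,-w)`. [cite: BorceaBranden2009II, §7 Thm. 7.3 (b)] -/
theorem map_negW {R S : Type*} [CommRing R] [CommRing S] (φ : R →+* S) (F : MvPolynomial (τ ⊕ τ) R) :
    map φ (negW F) = negW (map φ F) := by
  rw [negW, negW, map_bind₁,
    show (fun j => map φ (Sum.elim (fun i => X (Sum.inl i)) (fun i => -X (Sum.inr i)) j)) =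
        Sum.elim (fun i => (X (Sum.inl i) : MvPolynomial (τ ⊕ τ) S)) (fun i => -X (Sum.inr i)) from
      funext fun j => by rcases j with i | i <;> simp]

/-- **Borcea–Brändén II, Theorem 7.3 (b), sufficiency.** Let `T = Σ_{α ≤ β} Q_α(z) ∂^α/∂z^α` with real
polynomial coefficients and `F(z,w) = Σ_α Q_α(z) w^α`. If `F(z,-w)` is real stable then `T` preserves real
stability: for every real stable `f`, `T(f)` is real stable or identically zero (by complexification from
part (a)). [cite: BorceaBranden2009II, §7 Thm. 7.3 (b)] -/
theorem BorceaBranden_weylOp_realStable_or_zero [DecidableEq τ] {F : MvPolynomial (τ ⊕ τ) ℝ}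
    (hF : IsRealStable (negW F)) {f : MvPolynomial τ ℝ} (hf : IsRealStable f) :
    IsRealStable (weylOp F f) ∨ weylOp F f = 0 := by
  unfold IsRealStable at hF hf ⊢
  rw [map_negW] at hF
  rcases BorceaBranden_weylOp_stable_or_zero hF hf with h | h
  · left
    rwa [map_weylOp (algebraMap ℝ ℂ).injective]
  · right
    rw [← map_weylOp (algebraMap ℝ ℂ).injective] at h
    exact map_injective _ (algebraMap ℝ ℂ).injective (by rw [h, map_zero])

end Real

end Literature.Combinatorics.StablePolynomials

end
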